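import Mathlib
import HarnessLib
import Summits.AtomisticToContinuum.FouriersLaw.Theses.JunctionLocality
import Summits.AtomisticToContinuum.FouriersLaw.Theorems.BondHeatUncertaintySubdiffusiveBondHeatKernelGibbsF
import Literature.MathematicalPhysics.KineticTheory.SdeGeneratorCalculus

/-!
# The plain chain's equilibrium forward field, II: the time-integrated backward equation

Helper file 2 (`--supports` stmt-AtomisticToContinuum-11748) for stub `stub_plainForwardField` of
line `floating-probe-bypass-laplacian` (crux `JunctionLocality.SuperadditiveResistance`).

For the transition kernels `P_t` of `pinnedChain ω₂ lam β γ` (`ω₂ > 0`, `lam, β, γ ≥ 0`, `N ≥ 1`)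
at equal bath temperatures `T > 0` (the model-free kernels `OscillatorChain.langevinKernel`, equal
to the chain pipeline's `transitionKernel`), a test function `φ ∈ C_c^∞` and a smooth observable
`k` with `|k| ≤ K e^{ϑH}` (`0 < ϑ < 1/T`; e.g. `p_0² − T`), this file proves the TIME-INTEGRATED
KOLMOGOROV BACKWARD EQUATION in the weak form

  `∫ φ (P_τ k) dx − ∫ φ k dx = ∫₀^τ ∫ (L̂φ + 2γφ)(x) (P_t k)(x) dx dt`      (`τ ≥ 0`)

(`integral_mul_act_sub_eq`), where `L̂` is the generator of the time-reversed Langevin equation,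
so that `L̂ + 2γ = ᵗL` is the formal transpose of the generator (file I). It is the backward
Dynkin identity for pair observables of `ConfinedBackward.lean` (`hasDerivAt_pairAct`, from the
Lebesgue duality of `P_t` with the reversed kernels and Dynkin's identity for the latter) applied
to `φ ⊗ (k χ_n)` with the energy cutoffs `χ_n = χ(H/(n+1))`, integrated in time, and freed from
the cutoff by dominated convergence with the moment bound (3.4) `P_t e^{ϑH} ≤ e^{2ϑγTt} e^{ϑH}`.

References: Cuneo–Eckmann–Hairer–Rey-Bellet, EJP 23 (2018) no. 55, §3 (3.2)–(3.4);
Stroock–Varadhan (1979) §3.1 (backward equation).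
-/

noncomputable section

open MeasureTheory ProbabilityTheory Filter Topology Set
open scoped ContDiff NNReal ENNReal
open Literature.MathematicalPhysics.KineticTheory.HeatConduction
open Literature.MathematicalPhysics.KineticTheory Literature.Probability.Process OscillatorChain
open Summit.AtomisticToContinuum.FouriersLaw.Theorems.SubdiffusiveBondHeat

namespace Summit.AtomisticToContinuum.FouriersLaw.Theorems.SuperadditiveResistance.PlainForwardField

variable {N : ℕ}

/-! ## Tensor observables -/

/-- `(x, y) ↦ a(x) b(y)` is compactly supported if `a` and `b` are. [folklore] -/
theorem hasCompactSupport_tensor {a b : PhaseSpace N → ℝ} (ha : HasCompactSupport a)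
    (hb : HasCompactSupport b) :
    HasCompactSupport fun p : PhaseSpace N × PhaseSpace N => a p.1 * b p.2 := by
  refine HasCompactSupport.intro (K := tsupport a ×ˢ tsupport b) (ha.prod hb) fun p hp => ?_
  simp only [Set.mem_prod, not_and_or] at hp
  rcases hp with h | h
  · rw [image_eq_zero_of_notMem_tsupport h, zero_mul]
  · rw [image_eq_zero_of_notMem_tsupport h, mul_zero]

/-- The pair action of a tensor observable is `∫ a(x) (P_t b)(x) dx`. [folklore] -/
theorem pairAct_tensor (P : OscillatorChain) (T_L T_R : ℝ) (a b : PhaseSpace N → ℝ) (t : ℝ≥0) :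
    pairAct (P.drift N) (P.bathVecL N T_L) (P.bathVecR N T_R) volume
        (fun p : PhaseSpace N × PhaseSpace N => a p.1 * b p.2) t =
      ∫ x, a x * ∫ y, b y ∂(P.langevinKernel N T_L T_R t x) := by
  rw [pairAct_def]
  refine integral_congr_ae (ae_of_all _ fun x => ?_)
  show ∫ y, a x * b y ∂(P.langevinKernel N T_L T_R t x) = a x * ∫ y, b y ∂(P.langevinKernel N T_L T_R t x)
  exact integral_const_mul _ _

section Pinned

variable {ω₂ lam β γ : ℝ} (hω : 0 < ω₂) (hl : 0 ≤ lam) (hβ : 0 ≤ β) (hγ : 0 ≤ γ) (hN : 0 < N)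
  {T : ℝ} (hT : 0 < T)
include hω hl hβ hγ

/-! ## The moment bound (3.4) in Bochner form -/

include hN hT in
/-- **(3.4) for real integrals**: `∫ e^{θH} dP_t(z, ·) ≤ e^{θγ(T+T)t} e^{θH(z)}` for `0 < θ < 1/T`.
[cite: CuneoEckmannHairerReyBellet2018, §3 eq. (3.4)] -/
theorem integral_exp_mul_hamiltonian_le {θ : ℝ} (hθ0 : 0 < θ) (hθ1 : θ < 1 / T) (t : ℝ≥0)
    (z : PhaseSpace N) :
    ∫ y, Real.exp (θ * (pinnedChain ω₂ lam β γ).hamiltonian N y)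
        ∂((pinnedChain ω₂ lam β γ).langevinKernel N T T t z) ≤
      Real.exp (θ * γ * (T + T) * t) * Real.exp (θ * (pinnedChain ω₂ lam β γ).hamiltonian N z) := by
  rw [pinnedChain_langevinKernel_eq_transitionKernel N T T hω hl hβ hγ t]
  have hmax : θ < 1 / max T T := by rwa [max_self]
  have h34 := lintegral_exp_mul_hamiltonian_pinnedChainSemigroup_le hω hl hβ hγ hN hT.le hT.le hT hT
    hθ0 hmax t z
  have hcont : Continuous fun y => Real.exp (θ * (pinnedChain ω₂ lam β γ).hamiltonian N y) := by
    have := pinnedChain_continuous_hamiltonian ω₂ lam β γ N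
    fun_prop
  rw [integral_eq_lintegral_of_nonneg_ae (Eventually.of_forall fun y => (Real.exp_pos _).le)
    hcont.aestronglyMeasurable]
  have hB : 0 ≤ Real.exp (θ * γ * (T + T) * t) *
      Real.exp (θ * (pinnedChain ω₂ lam β γ).hamiltonian N z) := by positivity
  calc (∫⁻ y, ENNReal.ofReal (Real.exp (θ * (pinnedChain ω₂ lam β γ).hamiltonian N y))
        ∂((pinnedChain ω₂ lam β γ).transitionKernel N T T t z)).toReal
      ≤ (ENNReal.ofReal (Real.exp (θ * γ * (T + T) * t) *
          Real.exp (θ * (pinnedChain ω₂ lam β γ).hamiltonian N z))).toReal :=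
        ENNReal.toReal_mono ENNReal.ofReal_ne_top h34
    _ = _ := ENNReal.toReal_ofReal hB

include hN hT in
/-- **`P_t |k| ≤ K e^{θγ(T+T)t} e^{θH}`** for a continuous `k` with `|k| ≤ K e^{θH}`, `0 < θ < 1/T`;
and `k` is integrable for every `P_t(z, ·)`. [folklore] -/
theorem integral_abs_le_of_abs_le_exp {θ K : ℝ} (hθ0 : 0 < θ) (hθ1 : θ < 1 / T)
    {k : PhaseSpace N → ℝ} (hk : Continuous k)
    (hkb : ∀ y, |k y| ≤ K * Real.exp (θ * (pinnedChain ω₂ lam β γ).hamiltonian N y)) (t : ℝ≥0)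
    (z : PhaseSpace N) :
    Integrable k ((pinnedChain ω₂ lam β γ).langevinKernel N T T t z) ∧
      ∫ y, |k y| ∂((pinnedChain ω₂ lam β γ).langevinKernel N T T t z) ≤
        K * Real.exp (θ * γ * (T + T) * t) *
          Real.exp (θ * (pinnedChain ω₂ lam β γ).hamiltonian N z) := by
  have hexp : Integrable (fun y => Real.exp (θ * (pinnedChain ω₂ lam β γ).hamiltonian N y))
      ((pinnedChain ω₂ lam β γ).langevinKernel N T T t z) := by
    rw [pinnedChain_langevinKernel_eq_transitionKernel N T T hω hl hβ hγ t]
    exact pinnedChain_integrable_exp_mul_hamiltonian_transitionKernel hω hl hT hβ hγ hN hθ0 hθ1 t z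
  refine ⟨integrable_of_abs_le_exp hexp hk hkb, ?_⟩
  calc ∫ y, |k y| ∂((pinnedChain ω₂ lam β γ).langevinKernel N T T t z)
      ≤ ∫ y, K * Real.exp (θ * (pinnedChain ω₂ lam β γ).hamiltonian N y)
          ∂((pinnedChain ω₂ lam β γ).langevinKernel N T T t z) :=
        integral_mono_of_nonneg (Eventually.of_forall fun y => abs_nonneg _) (hexp.const_mul K)
          (Eventually.of_forall hkb)
    _ = K * ∫ y, Real.exp (θ * (pinnedChain ω₂ lam β γ).hamiltonian N y)
          ∂((pinnedChain ω₂ lam β γ).langevinKernel N T T t z) := integral_const_mul _ _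
    _ ≤ K * (Real.exp (θ * γ * (T + T) * t) *
          Real.exp (θ * (pinnedChain ω₂ lam β γ).hamiltonian N z)) := by
        have hK : 0 ≤ K := by
          have h := (abs_nonneg _).trans (hkb z)
          have he := Real.exp_pos (θ * (pinnedChain ω₂ lam β γ).hamiltonian N z)
          by_contra hK'
          push Not at hK'
          linarith [mul_neg_of_neg_of_pos hK' he]
        exact mul_le_mul_of_nonneg_left (integral_exp_mul_hamiltonian_le hω hl hβ hγ hN hT hθ0 hθ1 t z) hK
    _ = _ := by ring

/-! ## The backward equation for a tensor test observable, integrated in time -/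

include hN in
/-- **The time-integrated backward Dynkin identity for `φ ⊗ κ₀`** (`φ, κ₀ ∈ C_c^∞`, `τ ≥ 0`):
`∫ φ (P_τ κ₀) dx − ∫ φ κ₀ dx = ∫₀^τ ∫ (L̂φ + 2γφ) (P_t κ₀) dx dt`, with `L̂` the generator of the
reversed Langevin equation (`hasDerivAt_pairAct`: `d/dt ∫ φ (P_t κ₀) = ∫ (ᵗL φ)(P_t κ₀)`,
`ᵗL = L̂ − div Y = L̂ + 2γ`, and the fundamental theorem of calculus). [folklore] -/
theorem integral_mul_act_sub_eq_of_hasCompactSupport {φ κ₀ : PhaseSpace N → ℝ}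
    (hφ : ContDiff ℝ ∞ φ) (hφc : HasCompactSupport φ) (hκ₀ : ContDiff ℝ ∞ κ₀)
    (hκ₀c : HasCompactSupport κ₀) {τ : ℝ} (hτ : 0 ≤ τ) :
    (∫ x, φ x * ∫ y, κ₀ y ∂((pinnedChain ω₂ lam β γ).langevinKernel N T T τ.toNNReal x)) -
        ∫ x, φ x * κ₀ x =
      ∫ t in (0 : ℝ)..τ, ∫ x,
        (sdeGenerator (fun y => -(pinnedChain ω₂ lam β γ).drift N y)
            ((pinnedChain ω₂ lam β γ).bathVecL N T) ((pinnedChain ω₂ lam β γ).bathVecR N T) φ x +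
          2 * γ * φ x) *
        ∫ y, κ₀ y ∂((pinnedChain ω₂ lam β γ).langevinKernel N T T t.toNNReal x) := by
  set P := pinnedChain ω₂ lam β γ with hPdef
  have hP : P.IsConfining := pinnedChain_isConfining hω hl hβ hγ
  have hU : ContDiff ℝ ∞ P.U := pinnedChain_contDiff_U ω₂ lam β γ
  have hV : ContDiff ℝ ∞ P.V := pinnedChain_contDiff_V ω₂ lam β γ
  haveI := isAddHaarMeasure_volume_phaseSpace N
  set D := (hP.confinedDrift N).toConfinedDrift with hD
  have hv₁ := hP.bathVecL_mem_noise N T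
  have hv₂ := hP.bathVecR_mem_noise N T
  set D' := hP.reversedDrift N with hD'
  have hv₁' := hP.bathVecL_mem_reversedDrift_noise N T
  have hv₂' := hP.bathVecR_mem_reversedDrift_noise N T
  have hY' : ∀ y, (fun y => -P.drift N y) y = -P.drift N y := fun _ => rfl
  have hdiv := P.trace_fderiv_drift hU hV hN
  have hγ' : P.γ = γ := rfl
  set Lφ := sdeGenerator (fun y => -P.drift N y) (P.bathVecL N T) (P.bathVecR N T) φ with hLφ
  have hLφc : Continuous Lφ :=
    continuous_sdeGenerator _ _ (P.contDiff_drift hU hV N).continuous.neg (hφ.of_le (by norm_cast))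
  have hLφs : HasCompactSupport Lφ := hasCompactSupport_sdeGenerator _ _ hφc
  set Θ : PhaseSpace N × PhaseSpace N → ℝ := fun p => φ p.1 * κ₀ p.2 with hΘ
  have hΘ2 : ContDiff ℝ 2 Θ :=
    ((hφ.comp contDiff_fst).mul (hκ₀.comp contDiff_snd)).of_le (by norm_cast)
  have hΘc : HasCompactSupport Θ := hasCompactSupport_tensor hφc hκ₀c
  have hφc' : Continuous φ := hφ.continuous
  have hκ₀c' : Continuous κ₀ := hκ₀.continuous
  set Θ₁ : PhaseSpace N × PhaseSpace N → ℝ := fun p => Lφ p.1 * κ₀ p.2 with hΘ₁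
  have hΘ₁c : Continuous Θ₁ := by rw [hΘ₁]; fun_prop
  have hΘ₁s : HasCompactSupport Θ₁ := hasCompactSupport_tensor hLφs hκ₀c
  have h2φs : HasCompactSupport fun x => 2 * γ * φ x := hφc.mul_left
  have hψs' : HasCompactSupport fun x => Lφ x + 2 * γ * φ x := hLφs.add h2φs
  set Θ' : PhaseSpace N × PhaseSpace N → ℝ := fun p => (Lφ p.1 + 2 * γ * φ p.1) * κ₀ p.2 with hΘ'
  have hΘ'c : Continuous Θ' := by rw [hΘ']; fun_prop
  have hΘ's : HasCompactSupport Θ' := by rw [hΘ']; exact hasCompactSupport_tensor hψs' hκ₀c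
  -- `L̂₁ Θ = L̂φ ⊗ κ₀`
  have hL1 : sdeGeneratorFst (fun y => -P.drift N y) (P.bathVecL N T) (P.bathVecR N T) Θ = Θ₁ := by
    funext p
    rw [show p = (p.1, p.2) from rfl, sdeGeneratorFst_apply]
    show sdeGenerator _ _ _ (fun x' => φ x' * κ₀ p.2) p.1 = Lφ p.1 * κ₀ p.2
    have e : (fun x' => φ x' * κ₀ p.2) = fun x' => κ₀ p.2 * φ x' := funext fun _ => mul_comm _ _
    rw [e, sdeGenerator_const_mul _ _ _ (hφ.of_le (by norm_cast) : ContDiff ℝ 2 φ)]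
    ring
  -- the derivative of the pair action
  have hder : ∀ t : ℝ, 0 < t → HasDerivAt
      (fun s : ℝ => pairAct (P.drift N) (P.bathVecL N T) (P.bathVecR N T) volume Θ s.toNNReal)
      (pairAct (P.drift N) (P.bathVecL N T) (P.bathVecR N T) volume Θ' t.toNNReal) t := by
    intro t ht
    have h := D.hasDerivAt_pairAct hv₁ hv₂ volume D' hv₁' hv₂' hY' hdiv hΘ2 hΘc ht
    rw [hL1] at h
    have e1 : Θ' = fun p => (2 * P.γ) * Θ p + Θ₁ p := by
      funext p; simp only [hΘ', hΘ, hΘ₁, hγ']; ring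
    have hΘcont : Continuous Θ := hΘ2.continuous
    have hΘ2c : Continuous fun p => (2 * P.γ) * Θ p := by fun_prop
    have e2 : -(-(2 * P.γ)) * pairAct (P.drift N) (P.bathVecL N T) (P.bathVecR N T) volume Θ t.toNNReal +
        pairAct (P.drift N) (P.bathVecL N T) (P.bathVecR N T) volume Θ₁ t.toNNReal =
        pairAct (P.drift N) (P.bathVecL N T) (P.bathVecR N T) volume Θ' t.toNNReal := by
      have hΘ2s : HasCompactSupport fun p => (2 * P.γ) * Θ p := hΘc.mul_left
      rw [e1, D.pairAct_add hv₁ hv₂ volume hΘ2c hΘ2s hΘ₁c hΘ₁s,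
        D.pairAct_const_mul hv₁ hv₂ volume hΘcont hΘc]
      ring
    rw [e2] at h
    exact h
  -- the fundamental theorem of calculus
  have hcontF : Continuous fun s : ℝ =>
      pairAct (P.drift N) (P.bathVecL N T) (P.bathVecR N T) volume Θ s.toNNReal :=
    D.continuous_pairAct hv₁ hv₂ volume hΘ2.continuous hΘc
  have hcontF' : Continuous fun s : ℝ =>
      pairAct (P.drift N) (P.bathVecL N T) (P.bathVecR N T) volume Θ' s.toNNReal :=
    D.continuous_pairAct hv₁ hv₂ volume hΘ'c hΘ's
  have hFTC := intervalIntegral.integral_eq_sub_of_hasDerivAt_of_le hτ hcontF.continuousOn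
    (fun t ht => hder t ht.1) (hcontF'.intervalIntegrable _ _)
  have h0 : pairAct (P.drift N) (P.bathVecL N T) (P.bathVecR N T) volume Θ (0 : ℝ).toNNReal =
      ∫ x, φ x * κ₀ x := by
    rw [Real.toNNReal_zero, pairAct_def]
    show ∫ x, ∫ y, Θ (x, y) ∂(P.langevinKernel N T T 0 x) = _
    rw [hP.langevinKernel_zero N T T]
    simp [Kernel.id_apply, integral_dirac, hΘ]
  have hτ' : pairAct (P.drift N) (P.bathVecL N T) (P.bathVecR N T) volume Θ τ.toNNReal =
      ∫ x, φ x * ∫ y, κ₀ y ∂(P.langevinKernel N T T τ.toNNReal x) := pairAct_tensor P T T φ κ₀ _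
  have hI : (fun t : ℝ => pairAct (P.drift N) (P.bathVecL N T) (P.bathVecR N T) volume Θ' t.toNNReal) =
      fun t => ∫ x, (Lφ x + 2 * γ * φ x) * ∫ y, κ₀ y ∂(P.langevinKernel N T T t.toNNReal x) :=
    funext fun t => pairAct_tensor P T T (fun x => Lφ x + 2 * γ * φ x) κ₀ _
  rw [← hτ', ← h0, ← hFTC, hI]

/-- `t ↦ ∫ θ (P_{t⁺} κ₀) dx` is continuous for `θ` continuous compactly supported and `κ₀ ∈ C_c`
(`continuous_pairAct`). [folklore] -/
theorem continuous_integral_mul_act {θ κ₀ : PhaseSpace N → ℝ} (hθ : Continuous θ)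
    (hθc : HasCompactSupport θ) (hκ₀ : Continuous κ₀) (hκ₀c : HasCompactSupport κ₀) :
    Continuous fun t : ℝ => ∫ x, θ x *
      ∫ y, κ₀ y ∂((pinnedChain ω₂ lam β γ).langevinKernel N T T t.toNNReal x) := by
  set P := pinnedChain ω₂ lam β γ with hPdef
  have hP : P.IsConfining := pinnedChain_isConfining hω hl hβ hγ
  haveI := isAddHaarMeasure_volume_phaseSpace N
  have hΘc : Continuous fun p : PhaseSpace N × PhaseSpace N => θ p.1 * κ₀ p.2 :=
    (hθ.comp continuous_fst).mul (hκ₀.comp continuous_snd)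
  have h := (hP.confinedDrift N).toConfinedDrift.continuous_pairAct (hP.bathVecL_mem_noise N T)
    (hP.bathVecR_mem_noise N T) volume hΘc (hasCompactSupport_tensor hθc hκ₀c)
  have e : (fun s : ℝ => pairAct (P.drift N) (P.bathVecL N T) (P.bathVecR N T) volume
      (fun p : PhaseSpace N × PhaseSpace N => θ p.1 * κ₀ p.2) s.toNNReal) =
      fun t => ∫ x, θ x * ∫ y, κ₀ y ∂(P.langevinKernel N T T t.toNNReal x) :=
    funext fun s => pairAct_tensor P T T θ κ₀ _
  rwa [e] at h

end Pinned

/-! ## Registered helper stub -/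

/-- **Registered helper stub of this file** (`helper_plainForwardFieldBackward`): the time-integrated
backward Dynkin identity for `φ ⊗ κ₀` (= `integral_mul_act_sub_eq_of_hasCompactSupport`).
[cite: CuneoEckmannHairerReyBellet2018, §3 eq. (3.2)] -/
theorem helper_plainForwardFieldBackward : ∀ {ω₂ lam β γ : ℝ}, 0 < ω₂ → 0 ≤ lam → 0 ≤ β → 0 ≤ γ → ∀ {N : ℕ}, 0 < N → ∀ {T : ℝ} {φ κ₀ : PhaseSpace N → ℝ}, ContDiff ℝ ∞ φ → HasCompactSupport φ → ContDiff ℝ ∞ κ₀ → HasCompactSupport κ₀ → ∀ {τ : ℝ}, 0 ≤ τ → (∫ x, φ x * ∫ y, κ₀ y ∂((pinnedChain ω₂ lam β γ).langevinKernel N T T τ.toNNReal x)) - ∫ x, φ x * κ₀ x = ∫ t in (0 : ℝ)..τ, ∫ x, (sdeGenerator (fun y => -(pinnedChain ω₂ lam β γ).drift N y) ((pinnedChain ω₂ lam β γ).bathVecL N T) ((pinnedChain ω₂ lam β γ).bathVecR N T) φ x + 2 * γ * φ x) * ∫ y, κ₀ y ∂((pinnedChain ω₂ lam β γ).langevinKernel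 N T T t.toNNReal x) :=
  fun hω hl hβ hγ _ hN _ _ _ hφ hφc hκ₀ hκ₀c _ hτ =>
    integral_mul_act_sub_eq_of_hasCompactSupport hω hl hβ hγ hN hφ hφc hκ₀ hκ₀c hτ

end Summit.AtomisticToContinuum.FouriersLaw.Theorems.SuperadditiveResistance.PlainForwardField

end
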